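import Summits.NavierStokesRegularity.NavierStokesRegularity.Theorems.EfficiencyFloorRigidExitScaleClock
import Literature.Analysis.FunctionSpaces.SobolevImbeddingSup
import HarnessLib

/-!
# Route `EfficiencyFloor`, support `RigidExit` (stmt-25513) on the `ProductionEfficiencyDecay` ladder (stmt-22866):
# ADMISSIBLE PROFILES VANISH AT INFINITY (`H²(ℝ³) ⊂ C₀(ℝ³)`)

Helper file (`--supports stmt-NavierStokesRegularity-22866`; line `efficiency_floor`). The topological orbit-selection step of
`RigidExit` (`…RigidExitOrbitClosed`) uses that the maximiser profiles tend to `0` at spatial infinity. This file discharges that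
hypothesis for every ADMISSIBLE field of the route decls (`C^∞` with `D⁰, D¹, D² ∈ L²(ℝ³)`), from the tree's Sobolev imbedding
`W^{2,2}(ℝ³) → C_B` (`Literature.Analysis.FunctionSpaces.enorm_le_of_hasCompactSupport_dim_three`, Adams Thm. 5.4 / Lemma 5.15)
localised to balls:

* `tendsto_setLIntegral_ball_cocompact` (§1): tails of a finite integral — `∫⁻_{B_R(x₀)} G → 0` as `|x₀| → ∞` when `∫⁻ G < ∞`.
* `enorm_le_localSobolev` (§2): there is `K < ∞` with `‖g(x)‖ ≤ K · Σ_{j<3} (∫⁻_{B₃(x)} ‖Dʲg‖²)^{1/2}` for every `C²` map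
  `g : ℝ³ → ℝ³` and every `x` (translate, cut off with a fixed bump, Leibniz, imbedding of the compactly supported product).
* `tendsto_cocompact_of_sobolev` (§3): hence a `C²` map with `D⁰, D¹, D² ∈ L²(ℝ³)` tends to `0` at infinity;
  `tendsto_cocompact_of_admissible` — the same for the route's admissible clause verbatim.

HONEST FRAMING: a textbook embedding; nothing about Navier–Stokes is proved here; `RigidExit`, clause (a), `LerayFloorGap`,
`ProductionEfficiencyDecay` (stmt-22866) and Navier–Stokes regularity stay OPEN. [cite: Adams1975, Thm. 5.4 Part I Case C]
-/

-- the problem directory repeats the summit name (`NavierStokesRegularity/NavierStokesRegularity`)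
set_option linter.dupNamespace false

noncomputable section

open Set Filter MeasureTheory Topology Function Bornology Metric
open scoped ENNReal NNReal ContDiff

namespace Summit.NavierStokesRegularity.NavierStokesRegularity.Theorems

namespace RigidExit

namespace ProfileDecay

/-! ## §1 Tails of a finite integral -/

/-- **Tails of a finite integral over far-away balls vanish**: if `∫⁻ G < ∞` then `∫⁻_{B_R(x₀)} G → 0` as `|x₀| → ∞`
(the tails `∫⁻_{|x| ≥ n} G` of the finite measure `G dx` tend to `0`, and `B_R(x₀) ⊆ {|x| ≥ n}` once `|x₀| > n + R`). [folklore] -/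
theorem tendsto_setLIntegral_ball_cocompact {G : (EuclideanSpace ℝ (Fin 3)) → ℝ≥0∞} (hG : AEMeasurable G volume) (hfin : ∫⁻ x, G x < ⊤) (R : ℝ) :
    Tendsto (fun x₀ : (EuclideanSpace ℝ (Fin 3)) => ∫⁻ x in ball x₀ R, G x) (cocompact (EuclideanSpace ℝ (Fin 3))) (𝓝 0) := by
  set ν : Measure (EuclideanSpace ℝ (Fin 3)) := volume.withDensity G with hν
  have hνapp : ∀ s : Set (EuclideanSpace ℝ (Fin 3)), MeasurableSet s → ν s = ∫⁻ x in s, G x := fun s hs => by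
    rw [hν, withDensity_apply _ hs]
  haveI : IsFiniteMeasure ν := by
    refine ⟨?_⟩
    rw [hνapp _ MeasurableSet.univ, Measure.restrict_univ]
    exact hfin
  set S : ℕ → Set (EuclideanSpace ℝ (Fin 3)) := fun n => (ball (0 : (EuclideanSpace ℝ (Fin 3))) n)ᶜ with hS
  have hSanti : Antitone S := fun m n hmn => by
    simp only [hS]
    exact compl_subset_compl.2 (ball_subset_ball (by exact_mod_cast hmn))
  have hSempty : ⋂ n, S n = ∅ := by
    ext x
    simp only [hS, mem_iInter, mem_compl_iff, mem_ball, dist_zero_right, not_lt, mem_empty_iff_false,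
      iff_false, not_forall, not_le]
    exact exists_nat_gt ‖x‖
  have htail : Tendsto (fun n => ν (S n)) atTop (𝓝 0) := by
    have h := tendsto_measure_iInter_atTop (μ := ν) (s := S)
      (fun n => (measurableSet_ball.compl).nullMeasurableSet) hSanti ⟨0, measure_ne_top _ _⟩
    rwa [hSempty, measure_empty] at h
  rw [ENNReal.tendsto_nhds_zero]
  intro ε hε
  have hev := (ENNReal.tendsto_nhds_zero.1 htail) ε hε
  rw [eventually_atTop] at hev
  obtain ⟨n, hn⟩ := hev
  have hmem : {x₀ : (EuclideanSpace ℝ (Fin 3)) | (n : ℝ) + R < ‖x₀‖} ∈ cocompact (EuclideanSpace ℝ (Fin 3)) := by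
    have h := (isCompact_closedBall (0 : (EuclideanSpace ℝ (Fin 3))) ((n : ℝ) + R)).compl_mem_cocompact
    refine Filter.mem_of_superset h fun x₀ hx₀ => ?_
    simpa [mem_closedBall, dist_zero_right] using hx₀
  refine Filter.mem_of_superset hmem fun x₀ hx₀ => ?_
  have hsub : ball x₀ R ⊆ S n := by
    intro x hx
    simp only [hS, mem_compl_iff, mem_ball, dist_zero_right, not_lt]
    have h1 : dist x x₀ < R := hx
    have h2 : (n : ℝ) + R < ‖x₀‖ := hx₀
    have h3 : ‖x₀‖ ≤ ‖x‖ + dist x x₀ := by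
      calc ‖x₀‖ = dist x₀ 0 := (dist_zero_right x₀).symm
        _ ≤ dist x₀ x + dist x 0 := dist_triangle _ _ _
        _ = ‖x‖ + dist x x₀ := by rw [dist_zero_right, dist_comm, add_comm]
    linarith
  have _ := hG
  calc ∫⁻ x in ball x₀ R, G x ≤ ∫⁻ x in S n, G x := lintegral_mono_set hsub
    _ = ν (S n) := (hνapp _ measurableSet_ball.compl).symm
    _ ≤ ε := hn n le_rfl

/-! ## §2 The localised imbedding `‖g(x)‖ ≤ K Σⱼ ‖Dʲg‖_{L²(B₃(x))}` -/

/-- **Translation of ball integrals**: `∫⁻_{B_r(0)} G(y + x) dy = ∫⁻_{B_r(x)} G`. [folklore] -/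
theorem setLIntegral_ball_comp_add (G : (EuclideanSpace ℝ (Fin 3)) → ℝ≥0∞) (x : (EuclideanSpace ℝ (Fin 3))) (r : ℝ) :
    ∫⁻ y in ball (0 : (EuclideanSpace ℝ (Fin 3))) r, G (y + x) = ∫⁻ y in ball x r, G y := by
  rw [← lintegral_indicator measurableSet_ball, ← lintegral_indicator measurableSet_ball]
  have h : (fun y => (ball (0 : (EuclideanSpace ℝ (Fin 3))) r).indicator (fun y => G (y + x)) y) = fun y => (ball x r).indicator G (y + x) := by
    funext y
    by_cases hy : y ∈ ball (0 : (EuclideanSpace ℝ (Fin 3))) r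
    · have hy' : y + x ∈ ball x r := by
        rw [mem_ball, dist_eq_norm, add_sub_cancel_right]; rwa [mem_ball, dist_zero_right] at hy
      rw [indicator_of_mem hy, indicator_of_mem hy']
    · have hy' : y + x ∉ ball x r := by
        rw [mem_ball, dist_eq_norm, add_sub_cancel_right]; rwa [mem_ball, dist_zero_right] at hy
      rw [indicator_of_notMem hy, indicator_of_notMem hy']
  rw [h]
  exact lintegral_add_right_eq_self (fun z => (ball x r).indicator G z) x

/-- **Localised Sobolev imbedding in dimension three.** There is `K < ∞` such that for every `C²` map `g : ℝ³ → ℝ³` and every `x`,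
`‖g(x)‖ ≤ K · Σ_{j<3} (∫⁻_{B₃(x)} ‖Dʲg‖²)^{1/2}` (Adams' imbedding `W^{2,2} → C_B` for the compactly supported `C²` map
`φ · g(· + x)`, `φ` a fixed bump equal to `1` near `0` and supported in `B₂(0)`; Leibniz' bound for `D²(φ · g)`).
[cite: Adams1975, Thm. 5.4 Part I Case C (mp > n) and Lemma 5.15] -/
theorem enorm_le_localSobolev :
    ∃ K : ℝ≥0∞, K < ⊤ ∧ ∀ (g : (EuclideanSpace ℝ (Fin 3)) → (EuclideanSpace ℝ (Fin 3))), ContDiff ℝ 2 g → ∀ x : (EuclideanSpace ℝ (Fin 3)),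
      ‖g x‖ₑ ≤ K * ∑ j ∈ Finset.range 3, (∫⁻ y in ball x 3, ‖iteratedFDeriv ℝ j g y‖ₑ ^ 2) ^ (1 / 2 : ℝ) := by
  -- a fixed cutoff
  let φ : ContDiffBump (0 : (EuclideanSpace ℝ (Fin 3))) := ⟨1, 2, one_pos, one_lt_two⟩
  have hbd : ∀ i : ℕ, ∃ A : ℝ, ∀ y, ‖iteratedFDeriv ℝ i φ y‖ ≤ A := fun i =>
    (φ.contDiff.continuous_iteratedFDeriv (m := i)
      (by exact_mod_cast le_top)).bounded_above_of_compact_support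
        (φ.hasCompactSupport.iteratedFDeriv i)
  choose A hA using hbd
  set A' : ℝ := max (max (A 0) (A 1)) (max (A 2) 0) with hA'
  have hA'0 : 0 ≤ A' := le_max_of_le_right (le_max_right _ _)
  have hAi : ∀ i ∈ Finset.range 3, ∀ y, ‖iteratedFDeriv ℝ i φ y‖ ≤ A' := by
    intro i hi y
    have hi' : i = 0 ∨ i = 1 ∨ i = 2 := by
      have := Finset.mem_range.1 hi; omega
    rcases hi' with rfl | rfl | rfl
    · exact (hA 0 y).trans (le_max_of_le_left (le_max_left _ _))
    · exact (hA 1 y).trans (le_max_of_le_left (le_max_right _ _))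
    · exact (hA 2 y).trans (le_max_of_le_right (le_max_left _ _))
  obtain ⟨K₂, hK₂, hcpt⟩ := Literature.Analysis.FunctionSpaces.enorm_le_of_hasCompactSupport_dim_three
    (volume : Measure (EuclideanSpace ℝ (Fin 3))) (F := (EuclideanSpace ℝ (Fin 3))) (finrank_euclideanSpace_fin (𝕜 := ℝ) (n := 3))
  refine ⟨K₂ * (1 + ENNReal.ofReal (2 * A')), ENNReal.mul_lt_top hK₂
      (ENNReal.add_lt_top.2 ⟨ENNReal.one_lt_top, ENNReal.ofReal_lt_top⟩), fun g hg x => ?_⟩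
  -- the ball `B = B₃(0)` carrying the cutoff
  set B : Set (EuclideanSpace ℝ (Fin 3)) := ball (0 : (EuclideanSpace ℝ (Fin 3))) 3 with hBdef
  have hBφ : tsupport (φ : (EuclideanSpace ℝ (Fin 3)) → ℝ) ⊆ B := by
    rw [φ.tsupport_eq, hBdef]
    exact closedBall_subset_ball (by norm_num)
  -- translate and cut off
  set g' : (EuclideanSpace ℝ (Fin 3)) → (EuclideanSpace ℝ (Fin 3)) := fun y => g (y + x) with hg'
  have hg'c : ContDiff ℝ 2 g' := hg.comp ((contDiff_id).add contDiff_const)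
  set h : (EuclideanSpace ℝ (Fin 3)) → (EuclideanSpace ℝ (Fin 3)) := fun y => φ y • g' y with hh
  have hhc : ContDiff ℝ 2 h := (φ.contDiff (n := 2)).smul hg'c
  have hhs : HasCompactSupport h := φ.hasCompactSupport.smul_right
  have h0 : h 0 = g x := by
    simp only [hh, hg', zero_add]
    rw [φ.one_of_mem_closedBall (mem_closedBall_self φ.rIn_pos.le), one_smul]
  have hmain := hcpt hhc hhs
  rw [h0] at hmain
  -- local Sobolev pieces of `g` near `x`
  set T : ℕ → ℝ≥0∞ := fun j => (∫⁻ y in ball x 3, ‖iteratedFDeriv ℝ j g y‖ₑ ^ 2) ^ (1 / 2 : ℝ) with hT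
  set S := ∑ j ∈ Finset.range 3, T j with hS
  -- the restricted `L²` norm of `Dʲ g'` over `B` is `T j`
  have hnorm : ∀ j : ℕ, eLpNorm (B.indicator fun y => ‖iteratedFDeriv ℝ j g' y‖) 2 volume = T j := by
    intro j
    rw [eLpNorm_indicator_eq_eLpNorm_restrict measurableSet_ball,
      eLpNorm_eq_lintegral_rpow_enorm_toReal two_ne_zero ENNReal.ofNat_ne_top]
    simp only [ENNReal.toReal_ofNat, one_div]
    rw [hT]
    simp only [one_div]
    congr 1
    have h1 : ∀ y, ‖‖iteratedFDeriv ℝ j g' y‖‖ₑ ^ (2 : ℝ) = (fun z => ‖iteratedFDeriv ℝ j g z‖ₑ ^ 2) (y + x) := by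
      intro y
      rw [enorm_norm, hg', iteratedFDeriv_comp_add_right' j x]
      simp only
      rw [show (2 : ℝ) = ((2 : ℕ) : ℝ) by norm_num, ENNReal.rpow_natCast]
    simp_rw [h1]
    exact setLIntegral_ball_comp_add (fun z => ‖iteratedFDeriv ℝ j g z‖ₑ ^ 2) x 3
  -- `‖h‖₂ ≤ T 0 ≤ S`
  have hL2 : eLpNorm h 2 volume ≤ S := by
    calc eLpNorm h 2 volume ≤ eLpNorm (B.indicator fun y => ‖iteratedFDeriv ℝ 0 g' y‖) 2 volume := by
          refine eLpNorm_mono_real fun y => ?_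
          rw [hh]; dsimp only
          rw [norm_smul, Real.norm_of_nonneg φ.nonneg]
          by_cases hy : y ∈ B
          · rw [indicator_of_mem hy, norm_iteratedFDeriv_zero]
            exact mul_le_of_le_one_left (norm_nonneg _) φ.le_one
          · have hφ0 : φ y = 0 := by
              have : y ∉ tsupport (φ : (EuclideanSpace ℝ (Fin 3)) → ℝ) := fun h' => hy (hBφ h')
              exact image_eq_zero_of_notMem_tsupport this
            rw [hφ0, zero_mul, indicator_of_notMem hy]
      _ = T 0 := hnorm 0
      _ ≤ S := Finset.single_le_sum (f := T) (fun _ _ => zero_le) (Finset.mem_range.2 (by norm_num))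
  -- Leibniz: `‖D²h‖ ≤ 2A' Σ 1_B ‖D^{2-i} g'‖`
  have hLeib : ∀ y, ‖iteratedFDeriv ℝ 2 h y‖ ≤
      2 * A' * ∑ i ∈ Finset.range 3, B.indicator (fun y => ‖iteratedFDeriv ℝ (2 - i) g' y‖) y := by
    intro y
    by_cases hy : y ∈ B
    · simp only [indicator_of_mem hy]
      calc ‖iteratedFDeriv ℝ 2 h y‖ ≤ ∑ i ∈ Finset.range (2 + 1), ((2 : ℕ).choose i : ℝ) *
            ‖iteratedFDeriv ℝ i φ y‖ * ‖iteratedFDeriv ℝ (2 - i) g' y‖ :=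
            norm_iteratedFDeriv_smul_le (φ.contDiff (n := 2)) hg'c y le_rfl
        _ ≤ ∑ i ∈ Finset.range 3, 2 * A' * ‖iteratedFDeriv ℝ (2 - i) g' y‖ := by
            refine Finset.sum_le_sum fun i hi => ?_
            have hchoose : ((2 : ℕ).choose i : ℝ) ≤ 2 := by
              have : (2 : ℕ).choose i ≤ 2 := by
                have hi' : i = 0 ∨ i = 1 ∨ i = 2 := by
                  have := Finset.mem_range.1 hi; omega
                rcases hi' with rfl | rfl | rfl <;> decide
              exact_mod_cast this
            exact mul_le_mul_of_nonneg_right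
              (mul_le_mul hchoose (hAi i hi y) (norm_nonneg _) zero_le_two) (norm_nonneg _)
        _ = _ := by rw [Finset.mul_sum]
    · -- off `B` the cut-off product vanishes identically near `y`, so `D²h(y) = 0`
      have hy' : y ∉ tsupport h := fun h' => hy (hBφ (tsupport_smul_subset_left _ _ h'))
      have hzero : iteratedFDeriv ℝ 2 h y = 0 := by
        by_contra hne
        exact hy' (support_iteratedFDeriv_subset (𝕜 := ℝ) (n := 2) (f := h) (mem_support.2 hne))
      rw [hzero, norm_zero]
      simp only [indicator_of_notMem hy, Finset.sum_const_zero, mul_zero, le_refl]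
  have hD2 : eLpNorm (iteratedFDeriv ℝ 2 h) 2 volume ≤ ENNReal.ofReal (2 * A') * S := by
    calc eLpNorm (iteratedFDeriv ℝ 2 h) 2 volume
        ≤ eLpNorm (fun y => 2 * A' * ∑ i ∈ Finset.range 3, B.indicator (fun y => ‖iteratedFDeriv ℝ (2 - i) g' y‖) y) 2
            volume := eLpNorm_mono_real hLeib
      _ = ENNReal.ofReal (2 * A') *
            eLpNorm (∑ i ∈ Finset.range 3, B.indicator fun y => ‖iteratedFDeriv ℝ (2 - i) g' y‖) 2 volume := by
          have : (fun y => 2 * A' * ∑ i ∈ Finset.range 3, B.indicator (fun y => ‖iteratedFDeriv ℝ (2 - i) g' y‖) y) =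
              (2 * A') • ∑ i ∈ Finset.range 3, B.indicator fun y => ‖iteratedFDeriv ℝ (2 - i) g' y‖ := by
            ext y; simp only [Pi.smul_apply, Finset.sum_apply, smul_eq_mul]
          rw [this, eLpNorm_const_smul, Real.enorm_eq_ofReal (by positivity)]
      _ ≤ ENNReal.ofReal (2 * A') *
            ∑ i ∈ Finset.range 3, eLpNorm (B.indicator fun y => ‖iteratedFDeriv ℝ (2 - i) g' y‖) 2 volume := by
          gcongr
          refine eLpNorm_sum_le (fun i _ => ?_) one_le_two
          have hle : ((2 - i : ℕ) : ℕ∞ω) ≤ 2 := by exact_mod_cast Nat.sub_le 2 i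
          exact (((hg'c.continuous_iteratedFDeriv hle).norm).aestronglyMeasurable).indicator measurableSet_ball
      _ = ENNReal.ofReal (2 * A') * S := by
          have hsum : ∑ i ∈ Finset.range 3,
              eLpNorm (B.indicator fun y => ‖iteratedFDeriv ℝ (2 - i) g' y‖) 2 volume = S := by
            rw [hS, ← Finset.sum_range_reflect _ 3]
            refine Finset.sum_congr rfl fun i hi => ?_
            rw [hnorm]
            have h2i : 2 - (3 - 1 - i) = i := by
              have := Finset.mem_range.1 hi; omega
            rw [h2i]
          rw [hsum]
  calc ‖g x‖ₑ ≤ K₂ * (eLpNorm h 2 volume + eLpNorm (iteratedFDeriv ℝ 2 h) 2 volume) := hmain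
    _ ≤ K₂ * (S + ENNReal.ofReal (2 * A') * S) := by gcongr
    _ = K₂ * (1 + ENNReal.ofReal (2 * A')) * S := by ring

/-! ## §3 `H²(ℝ³) ∩ C² ⊂ C₀(ℝ³)` -/

/-- **`C²` maps with `D⁰, D¹, D² ∈ L²(ℝ³)` vanish at infinity.** [cite: Adams1975, Thm. 5.4 Part I Case C] -/
theorem tendsto_cocompact_of_sobolev {g : (EuclideanSpace ℝ (Fin 3)) → (EuclideanSpace ℝ (Fin 3))} (hg : ContDiff ℝ 2 g)
    (h0 : ∫⁻ x, ‖iteratedFDeriv ℝ 0 g x‖ₑ ^ 2 < ⊤) (h1 : ∫⁻ x, ‖iteratedFDeriv ℝ 1 g x‖ₑ ^ 2 < ⊤)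
    (h2 : ∫⁻ x, ‖iteratedFDeriv ℝ 2 g x‖ₑ ^ 2 < ⊤) :
    Tendsto g (cocompact (EuclideanSpace ℝ (Fin 3))) (𝓝 0) := by
  obtain ⟨K, hK, hbound⟩ := enorm_le_localSobolev
  -- each local piece tends to `0`
  have hT : ∀ j ∈ Finset.range 3, Tendsto (fun x : (EuclideanSpace ℝ (Fin 3)) => (∫⁻ y in ball x 3, ‖iteratedFDeriv ℝ j g y‖ₑ ^ 2) ^ (1 / 2 : ℝ))
      (cocompact (EuclideanSpace ℝ (Fin 3))) (𝓝 0) := by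
    intro j hj
    have hfin : ∫⁻ y, ‖iteratedFDeriv ℝ j g y‖ₑ ^ 2 < ⊤ := by
      have hj' : j = 0 ∨ j = 1 ∨ j = 2 := by
        have := Finset.mem_range.1 hj; omega
      rcases hj' with rfl | rfl | rfl
      · exact h0
      · exact h1
      · exact h2
    have hjle : ((j : ℕ) : ℕ∞ω) ≤ 2 := by
      have := Finset.mem_range.1 hj
      exact_mod_cast (by omega : j ≤ 2)
    have hmeas : AEMeasurable (fun y => ‖iteratedFDeriv ℝ j g y‖ₑ ^ 2) volume :=
      ((hg.continuous_iteratedFDeriv hjle).enorm.measurable.pow_const _).aemeasurable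
    have ht := tendsto_setLIntegral_ball_cocompact hmeas hfin 3
    have := ((ENNReal.continuous_rpow_const (y := (1 / 2 : ℝ))).tendsto (0 : ℝ≥0∞)).comp ht
    rwa [ENNReal.zero_rpow_of_pos (by norm_num : (0 : ℝ) < 1 / 2)] at this
  have hsum : Tendsto (fun x : (EuclideanSpace ℝ (Fin 3)) => K * ∑ j ∈ Finset.range 3,
      (∫⁻ y in ball x 3, ‖iteratedFDeriv ℝ j g y‖ₑ ^ 2) ^ (1 / 2 : ℝ)) (cocompact (EuclideanSpace ℝ (Fin 3))) (𝓝 0) := by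
    have h1 := tendsto_finsetSum (Finset.range 3) hT
    rw [Finset.sum_const_zero] at h1
    have h2 := ENNReal.Tendsto.const_mul h1 (Or.inr hK.ne)
    rwa [mul_zero] at h2
  have henorm : Tendsto (fun x => ‖g x‖ₑ) (cocompact (EuclideanSpace ℝ (Fin 3))) (𝓝 0) :=
    tendsto_of_tendsto_of_tendsto_of_le_of_le tendsto_const_nhds hsum (fun _ => zero_le) fun x => hbound g hg x
  -- from `‖g x‖ₑ → 0` to `g x → 0`
  rw [tendsto_zero_iff_norm_tendsto_zero]
  have h3 := (ENNReal.tendsto_toReal ENNReal.zero_ne_top).comp henorm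
  rw [ENNReal.toReal_zero] at h3
  refine h3.congr fun x => ?_
  simp

/-- **Admissible fields of the route decls vanish at infinity** (`C^∞`, divergence free, `D⁰, D¹, D² ∈ L²(ℝ³)` ⟹ `m → 0` at
infinity). [cite: Adams1975, Thm. 5.4 Part I Case C] -/
theorem tendsto_cocompact_of_admissible {m : (EuclideanSpace ℝ (Fin 3)) → (EuclideanSpace ℝ (Fin 3))}
    (hm : ContDiff ℝ (⊤ : ℕ∞) m ∧ Literature.Analysis.FluidPDE.VectorCalculus.IsDivFree m ∧
      (∫⁻ x, ‖iteratedFDeriv ℝ 0 m x‖ₑ ^ 2 < ⊤) ∧ (∫⁻ x, ‖iteratedFDeriv ℝ 1 m x‖ₑ ^ 2 < ⊤) ∧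
      (∫⁻ x, ‖iteratedFDeriv ℝ 2 m x‖ₑ ^ 2 < ⊤)) :
    Tendsto m (cocompact (EuclideanSpace ℝ (Fin 3))) (𝓝 0) :=
  tendsto_cocompact_of_sobolev (hm.1.of_le (by norm_cast)) hm.2.2.1 hm.2.2.2.1 hm.2.2.2.2

end ProfileDecay

end RigidExit

end Summit.NavierStokesRegularity.NavierStokesRegularity.Theorems
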